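import Literature.NumberTheory.Transcendental.HermiteInterpolationBound
import HarnessLib

/-!
# Hermite extrapolation with TAYLOR-NORMALISED approximate jets

Topic `Literature/NumberTheory/Transcendental`. Support file (proofs only; no definitions, no named facts), sequel to
`HermiteInterpolationBound.lean`.  The tree's `Hermite.norm_le_of_small_jets` takes the jets of the entire function `f` at
the interpolation points in the UN-normalised form `|f^{(σ)}(e)| ≤ ε` (`σ < S`).  Nesterenko's interpolation formula
(Yu. V. Nesterenko, *Linear forms in logarithms of rational numbers*, LNM 1819 (2003), §4.1 (4.8)–(4.9), Lemma 4.2) consumes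
the TAYLOR COEFFICIENTS `f^{(σ)}(e)/σ!` instead ((4.9): `f₂` is a sum over `f^{(τ)}(x)/τ!`; Lemma 4.3 bounds `(1/t!)f^{(t)}(x)`,
(4.19)), and this normalisation is what makes the cost per derivative of his k-step `log(eBN) + O(1)` rather than a height
((4.20)–(4.23)).  Here we prove that the hypothesis `|f^{(σ)}(e)| ≤ σ!·ε` gives the IDENTICAL conclusions:

* `Hermite.norm_interp_le_of_taylor` — the interpolant bound `|H(z)| ≤ N S ε (2(t+r))^{SN} (2/δ)^S / Λ₀^S` on `|z| ≤ t`;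
* `Hermite.norm_le_of_small_taylor_jets` — `|f(w)| ≤ 𝓗(ρ) + (B + 𝓗(R))·((ρ+r)/(R−r))^{SN}` for `|w| ≤ ρ ≤ R`.

The only change in the proof is in the Taylor coefficients of `φ_e = f/Λ_e` at `e`: by Leibniz,
`φ_e^{(k)}(e)/k! = Σᵢ (f^{(i)}(e)/i!)·((Λ_e⁻¹)^{(k−i)}(e)/(k−i)!)`, and Cauchy's estimate `|(Λ_e⁻¹)^{(j)}(e)|/j! ≤ 2^{S(N−1)}(2/δ)^j`
gives `|φ_e^{(k)}(e)/k!| ≤ (k+1)·ε·2^{S(N−1)}(2/δ)^S ≤ ε·2^{SN}(2/δ)^S` for `k < S` (`k + 1 ≤ 2^k ≤ 2^S`) — the same bound as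
with un-normalised jets (where `Σᵢ C(k,i) = 2^k` was spent instead).  Everything else (`iteratedDeriv_sub_interp_eq_zero`,
the basis bounds, the maximum modulus step) is imported unchanged.

## References

* Yu. V. Nesterenko, *Linear forms in logarithms of rational numbers*, in: Diophantine Approximation (Cetraro 2000),
  LNM 1819, Springer 2003, 53–106 — §4.1 (4.8)–(4.9) p. 81–82, Lemma 4.2 (4.10)–(4.13) p. 82–83; §4.2 Lemma 4.3 (4.19)
  p. 84. [Nesterenko2003]
* M. Waldschmidt, *Diophantine Approximation on Linear Algebraic Groups*, Grundlehren 326, Springer 2000, §9.1. [folklore]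
-/

noncomputable section

open Complex Metric Finset Filter Topology

namespace Literature.NumberTheory.Transcendental

namespace Hermite

/-- **Size of the Hermite interpolant, Taylor-normalised jets.** With `|e| ≤ r` on `E` (`r ≥ 1`), pairwise distances
`≥ δ ∈ (0, 1]`, `∏_{e' ≠ e}|e - e'| ≥ Λ₀ > 0` and `|f^{(σ)}(e)| ≤ σ!·ε` for `σ < S`, `e ∈ E`: for `|z| ≤ t` (`t ≥ 0`),
`|H(z)| ≤ N·S·ε·(2(t+r))^{SN}·(2/δ)^S/Λ₀^S`, `N = #E` — the same bound as `norm_interp_le`.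
[cite: Nesterenko2003, §4.1 (4.8)–(4.9), Lemma 4.2 (4.10)–(4.13), p. 81–83] -/
theorem norm_interp_le_of_taylor {f : ℂ → ℂ} (hf : Differentiable ℂ f) (E : Finset ℂ) (S : ℕ)
    {r δ Λ₀ ε : ℝ} (hr : 1 ≤ r) (hδ : 0 < δ) (hδ1 : δ ≤ 1) (hΛ₀ : 0 < Λ₀) (hε : 0 ≤ ε)
    (hE : ∀ e ∈ E, ‖e‖ ≤ r) (hsep : ∀ e₁ ∈ E, ∀ e₂ ∈ E, e₁ ≠ e₂ → δ ≤ ‖e₁ - e₂‖)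
    (hprod : ∀ e ∈ E, Λ₀ ≤ ∏ e' ∈ E.erase e, ‖e - e'‖)
    (hsmall : ∀ e ∈ E, ∀ σ < S, ‖iteratedDeriv σ f e‖ ≤ σ.factorial * ε)
    (Λ φ : ℂ → ℂ → ℂ) (a : ℂ → ℕ → ℂ) (J : ℂ → ℂ → ℂ) (H : ℂ → ℂ)
    (hΛ : Λ = fun e z => ∏ e' ∈ E.erase e, ((z - e') / (e - e')) ^ S)
    (hφ : φ = fun e z => f z * (Λ e z)⁻¹)
    (ha : a = fun e k => iteratedDeriv k (φ e) e / k.factorial)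
    (hJ : J = fun e z => ∑ k ∈ Finset.range S, a e k * (z - e) ^ k)
    (hH : H = fun z => ∑ e ∈ E, Λ e z * J e z)
    {t : ℝ} (ht : 0 ≤ t) {z : ℂ} (hz : ‖z‖ ≤ t) :
    ‖H z‖ ≤ E.card * S * ε * (2 * (t + r)) ^ (S * E.card) * (2 / δ) ^ S / Λ₀ ^ S := by
  set N : ℕ := E.card with hN
  have hΛd : ∀ e', Differentiable ℂ (Λ e') := fun e' => by
    rw [hΛ]; exact differentiable_basis E e' S
  have htr : 1 ≤ t + r := by linarith
  have h2δ : 1 ≤ 2 / δ := by rw [le_div_iff₀ hδ]; linarith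
  -- (1) the Taylor coefficients of `φ_e` at `e`
  have hcoef : ∀ e ∈ E, ∀ k < S, ‖a e k‖ ≤ ε * 2 ^ (S * N) * (2 / δ) ^ S := by
    intro e he k hk
    have hcard : (E.erase e).card = N - 1 := by rw [Finset.card_erase_of_mem he]
    have hN1 : 1 ≤ N := Finset.card_pos.mpr ⟨e, he⟩
    have hΛe : Λ e e = 1 := by rw [hΛ]; exact basis_self E e S
    have hinvc : ContDiffAt ℂ k (fun z => (Λ e z)⁻¹) e :=
      ((hΛd e).contDiff.contDiffAt).inv (by rw [hΛe]; exact one_ne_zero)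
    -- Leibniz
    have hL : iteratedDeriv k (φ e) e = ∑ i ∈ Finset.range (k + 1),
        (k.choose i : ℂ) * iteratedDeriv i f e * iteratedDeriv (k - i) (fun z => (Λ e z)⁻¹) e := by
      rw [hφ]
      exact iteratedDeriv_fun_mul hf.contDiff.contDiffAt hinvc
    -- Cauchy for `1/Λ_e`
    have hinv : ∀ i, ‖iteratedDeriv i (fun z => (Λ e z)⁻¹) e‖ ≤
        i.factorial * (2 : ℝ) ^ (S * (N - 1)) / (δ / 2) ^ i := by
      intro i
      have := norm_iteratedDeriv_inv_basis_le E he S hδ hsep i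
      rw [hcard] at this
      rw [hΛ]
      exact this
    -- termwise bound: `choose · i! · (k−i)! · ε · 2^{S(N-1)} (2/δ)^S = k! · ε · (…)`
    have hterm : ∀ i ∈ Finset.range (k + 1),
        ‖(k.choose i : ℂ) * iteratedDeriv i f e * iteratedDeriv (k - i) (fun z => (Λ e z)⁻¹) e‖ ≤
          k.factorial * (ε * ((2 : ℝ) ^ (S * (N - 1)) * (2 / δ) ^ S)) := by
      intro i hi
      have hik : i ≤ k := Nat.lt_succ_iff.mp (Finset.mem_range.mp hi)
      rw [norm_mul, norm_mul, Complex.norm_natCast]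
      have h1 : ‖iteratedDeriv i f e‖ ≤ i.factorial * ε := hsmall e he i (by omega)
      have h2 : ‖iteratedDeriv (k - i) (fun z => (Λ e z)⁻¹) e‖ ≤
          (k - i).factorial * ((2 : ℝ) ^ (S * (N - 1)) * (2 / δ) ^ S) := by
        calc ‖iteratedDeriv (k - i) (fun z => (Λ e z)⁻¹) e‖
            ≤ (k - i).factorial * (2 : ℝ) ^ (S * (N - 1)) / (δ / 2) ^ (k - i) := hinv (k - i)
          _ = (k - i).factorial * ((2 : ℝ) ^ (S * (N - 1)) * (2 / δ) ^ (k - i)) := by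
              rw [div_eq_mul_inv, ← inv_pow, inv_div]; ring
          _ ≤ (k - i).factorial * ((2 : ℝ) ^ (S * (N - 1)) * (2 / δ) ^ S) :=
              mul_le_mul_of_nonneg_left
                (mul_le_mul_of_nonneg_left (pow_le_pow_right₀ h2δ (by omega)) (by positivity))
                (Nat.cast_nonneg _)
      have hchoose : (k.choose i : ℝ) * i.factorial * (k - i).factorial = k.factorial := by
        exact_mod_cast Nat.choose_mul_factorial_mul_factorial hik
      calc (k.choose i : ℝ) * ‖iteratedDeriv i f e‖ * ‖iteratedDeriv (k - i) (fun z => (Λ e z)⁻¹) e‖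
          ≤ (k.choose i : ℝ) * (i.factorial * ε) * ((k - i).factorial * ((2 : ℝ) ^ (S * (N - 1)) * (2 / δ) ^ S)) := by
            refine mul_le_mul (mul_le_mul_of_nonneg_left h1 (Nat.cast_nonneg _)) h2 (norm_nonneg _) ?_
            positivity
        _ = (k.choose i : ℝ) * i.factorial * (k - i).factorial * (ε * ((2 : ℝ) ^ (S * (N - 1)) * (2 / δ) ^ S)) := by
            ring
        _ = k.factorial * (ε * ((2 : ℝ) ^ (S * (N - 1)) * (2 / δ) ^ S)) := by rw [hchoose]
    have hnorm : ‖iteratedDeriv k (φ e) e‖ ≤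
        ((k + 1 : ℕ) : ℝ) * (k.factorial * (ε * ((2 : ℝ) ^ (S * (N - 1)) * (2 / δ) ^ S))) := by
      rw [hL]
      calc ‖∑ i ∈ Finset.range (k + 1), (k.choose i : ℂ) * iteratedDeriv i f e *
              iteratedDeriv (k - i) (fun z => (Λ e z)⁻¹) e‖
          ≤ ∑ i ∈ Finset.range (k + 1), ‖(k.choose i : ℂ) * iteratedDeriv i f e *
              iteratedDeriv (k - i) (fun z => (Λ e z)⁻¹) e‖ := norm_sum_le _ _
        _ ≤ ∑ i ∈ Finset.range (k + 1), (k.factorial * (ε * ((2 : ℝ) ^ (S * (N - 1)) * (2 / δ) ^ S))) :=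
            Finset.sum_le_sum hterm
        _ = ((k + 1 : ℕ) : ℝ) * (k.factorial * (ε * ((2 : ℝ) ^ (S * (N - 1)) * (2 / δ) ^ S))) := by
            rw [Finset.sum_const, Finset.card_range, nsmul_eq_mul]
    -- divide by `k!`; `k + 1 ≤ 2^k ≤ 2^S`
    have hkf : (0 : ℝ) < k.factorial := by exact_mod_cast Nat.factorial_pos k
    have hk2 : ((k + 1 : ℕ) : ℝ) ≤ (2 : ℝ) ^ S := by
      have h1 : k + 1 ≤ 2 ^ k := Nat.lt_two_pow_self
      have h2 : 2 ^ k ≤ 2 ^ S := Nat.pow_le_pow_right (by norm_num) hk.le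
      exact_mod_cast h1.trans h2
    rw [ha]
    simp only
    rw [norm_div, Complex.norm_natCast, div_le_iff₀ hkf]
    calc ‖iteratedDeriv k (φ e) e‖
        ≤ ((k + 1 : ℕ) : ℝ) * (k.factorial * (ε * ((2 : ℝ) ^ (S * (N - 1)) * (2 / δ) ^ S))) := hnorm
      _ ≤ (2 : ℝ) ^ S * (k.factorial * (ε * ((2 : ℝ) ^ (S * (N - 1)) * (2 / δ) ^ S))) :=
          mul_le_mul_of_nonneg_right hk2 (by positivity)
      _ = ε * 2 ^ (S * N) * (2 / δ) ^ S * k.factorial := by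
          have : (2 : ℝ) ^ S * (2 : ℝ) ^ (S * (N - 1)) = 2 ^ (S * N) := by
            rw [← pow_add]
            congr 1
            obtain ⟨N', hN'⟩ : ∃ N', N = N' + 1 := ⟨N - 1, by omega⟩
            rw [hN', Nat.add_sub_cancel]; ring
          rw [← this]; ring
  -- (2) the Taylor polynomials
  have hJb : ∀ e ∈ E, ‖J e z‖ ≤ S * (ε * 2 ^ (S * N) * (2 / δ) ^ S) * (t + r) ^ S := by
    intro e he
    rw [hJ]
    simp only
    have hze : ‖z - e‖ ≤ t + r :=
      (norm_sub_le _ _).trans (add_le_add hz (hE e he))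
    calc ‖∑ k ∈ Finset.range S, a e k * (z - e) ^ k‖
        ≤ ∑ k ∈ Finset.range S, ‖a e k * (z - e) ^ k‖ := norm_sum_le _ _
      _ ≤ ∑ k ∈ Finset.range S, (ε * 2 ^ (S * N) * (2 / δ) ^ S) * (t + r) ^ S := by
          refine Finset.sum_le_sum fun k hk => ?_
          have hkS : k < S := Finset.mem_range.mp hk
          rw [norm_mul, norm_pow]
          refine mul_le_mul (hcoef e he k hkS) ?_ (by positivity) (by positivity)
          exact (pow_le_pow_left₀ (norm_nonneg _) hze k).trans (pow_le_pow_right₀ htr hkS.le)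
      _ = S * (ε * 2 ^ (S * N) * (2 / δ) ^ S) * (t + r) ^ S := by
          rw [Finset.sum_const, Finset.card_range, nsmul_eq_mul]; ring
  -- (3) the basis
  have hΛb : ∀ e ∈ E, ‖Λ e z‖ ≤ (t + r) ^ (S * (N - 1)) / Λ₀ ^ S := by
    intro e he
    have hcard : (E.erase e).card = N - 1 := by rw [Finset.card_erase_of_mem he]
    rw [hΛ]
    simp only
    calc ‖∏ e' ∈ E.erase e, ((z - e') / (e - e')) ^ S‖
        ≤ (t + r) ^ (S * (E.erase e).card) / (∏ e' ∈ E.erase e, ‖e - e'‖) ^ S :=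
          norm_basis_le E e S hE hz
      _ ≤ (t + r) ^ (S * (N - 1)) / Λ₀ ^ S := by
          rw [hcard]
          refine div_le_div_of_nonneg_left (by positivity) (by positivity) ?_
          exact pow_le_pow_left₀ hΛ₀.le (hprod e he) S
  -- (4) summation
  rw [hH]
  simp only
  by_cases hE0 : E = ∅
  · subst hE0; simp
  have hN1 : 1 ≤ N := Finset.card_pos.mpr (Finset.nonempty_iff_ne_empty.mpr hE0)
  calc ‖∑ e ∈ E, Λ e z * J e z‖ ≤ ∑ e ∈ E, ‖Λ e z * J e z‖ := norm_sum_le _ _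
    _ ≤ ∑ e ∈ E, (t + r) ^ (S * (N - 1)) / Λ₀ ^ S *
          (S * (ε * 2 ^ (S * N) * (2 / δ) ^ S) * (t + r) ^ S) := by
        refine Finset.sum_le_sum fun e he => ?_
        rw [norm_mul]
        exact mul_le_mul (hΛb e he) (hJb e he) (norm_nonneg _) (by positivity)
    _ = N * ((t + r) ^ (S * (N - 1)) / Λ₀ ^ S *
          (S * (ε * 2 ^ (S * N) * (2 / δ) ^ S) * (t + r) ^ S)) := by
        rw [Finset.sum_const, nsmul_eq_mul]
    _ = E.card * S * ε * (2 * (t + r)) ^ (S * E.card) * (2 / δ) ^ S / Λ₀ ^ S := by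
        rw [← hN, mul_pow]
        have e1 : (t + r) ^ (S * (N - 1)) * (t + r) ^ S = (t + r) ^ (S * N) := by
          rw [← pow_add]
          congr 1
          obtain ⟨N', hN'⟩ : ∃ N', N = N' + 1 := ⟨N - 1, by omega⟩
          rw [hN']; simp [Nat.mul_succ]
        field_simp
        rw [← e1]
        ring

/-- **Hermite extrapolation with Taylor-normalised approximate data.** Let `f` be entire, `E` a finite set of `N` points
of modulus `≤ r` (`r ≥ 1`), pairwise at distance `≥ δ ∈ (0,1]`, with `∏_{e' ≠ e} |e - e'| ≥ Λ₀ > 0` for all `e ∈ E`;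
suppose `|f^{(σ)}(e)| ≤ σ!·ε` for all `e ∈ E`, `σ < S`, and `|f| ≤ B` on `|z| = R`, `r < R`.  Then for `|w| ≤ ρ ≤ R`,
`|f(w)| ≤ 𝓗(ρ) + (B + 𝓗(R)) · ((ρ + r)/(R - r))^{SN}` with `𝓗(t) = N S ε (2(t+r))^{SN} (2/δ)^S / Λ₀^S` — the SAME conclusion
as `norm_le_of_small_jets`. [cite: Nesterenko2003, §4.1 (4.8)–(4.11), Lemma 4.2, p. 81–83] -/
theorem norm_le_of_small_taylor_jets {f : ℂ → ℂ} (hf : Differentiable ℂ f) (E : Finset ℂ) (S : ℕ)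
    {r R ρ δ Λ₀ ε B : ℝ} (hr : 1 ≤ r) (hρ : 0 ≤ ρ) (hρR : ρ ≤ R) (hrR : r < R) (hδ : 0 < δ)
    (hδ1 : δ ≤ 1) (hΛ₀ : 0 < Λ₀) (hε : 0 ≤ ε)
    (hE : ∀ e ∈ E, ‖e‖ ≤ r) (hsep : ∀ e₁ ∈ E, ∀ e₂ ∈ E, e₁ ≠ e₂ → δ ≤ ‖e₁ - e₂‖)
    (hprod : ∀ e ∈ E, Λ₀ ≤ ∏ e' ∈ E.erase e, ‖e - e'‖)
    (hsmall : ∀ e ∈ E, ∀ σ < S, ‖iteratedDeriv σ f e‖ ≤ σ.factorial * ε)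
    (hB : ∀ z ∈ sphere (0 : ℂ) R, ‖f z‖ ≤ B) {w : ℂ} (hw : ‖w‖ ≤ ρ) :
    ‖f w‖ ≤ E.card * S * ε * (2 * (ρ + r)) ^ (S * E.card) * (2 / δ) ^ S / Λ₀ ^ S +
      (B + E.card * S * ε * (2 * (R + r)) ^ (S * E.card) * (2 / δ) ^ S / Λ₀ ^ S) *
        ((ρ + r) / (R - r)) ^ (S * E.card) := by
  -- the interpolant and its two properties
  set Λ : ℂ → ℂ → ℂ := fun e z => ∏ e' ∈ E.erase e, ((z - e') / (e - e')) ^ S with hΛ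
  set φ : ℂ → ℂ → ℂ := fun e z => f z * (Λ e z)⁻¹ with hφ
  set a : ℂ → ℕ → ℂ := fun e k => iteratedDeriv k (φ e) e / k.factorial with ha
  set J : ℂ → ℂ → ℂ := fun e z => ∑ k ∈ Finset.range S, a e k * (z - e) ^ k with hJ
  set H : ℂ → ℂ := fun z => ∑ e ∈ E, Λ e z * J e z with hH
  set 𝓗 : ℝ → ℝ := fun t => E.card * S * ε * (2 * (t + r)) ^ (S * E.card) * (2 / δ) ^ S / Λ₀ ^ S
    with h𝓗
  have hHb : ∀ {t : ℝ}, 0 ≤ t → ∀ {z : ℂ}, ‖z‖ ≤ t → ‖H z‖ ≤ 𝓗 t := fun ht z hz =>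
    norm_interp_le_of_taylor hf E S hr hδ hδ1 hΛ₀ hε hE hsep hprod hsmall Λ φ a J H rfl rfl rfl rfl rfl ht hz
  have hjets : ∀ e ∈ E, ∀ j < S, iteratedDeriv j (fun z => f z - H z) e = 0 := fun e he j hj =>
    iteratedDeriv_sub_interp_eq_zero hf E S Λ φ a J H rfl rfl rfl rfl rfl he hj
  -- `g = f - H` is entire and vanishes to order `S` on `E`
  have hΛd : ∀ e', Differentiable ℂ (Λ e') := fun e' => differentiable_basis E e' S
  have hJd : ∀ e', Differentiable ℂ (J e') := fun e' => by
    show Differentiable ℂ fun z => ∑ k ∈ Finset.range S, a e' k * (z - e') ^ k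
    fun_prop
  have hHd : Differentiable ℂ H := Differentiable.fun_sum fun e' _ => (hΛd e').mul (hJd e')
  have hg : Differentiable ℂ (fun z => f z - H z) := hf.sub hHd
  have horder : ∀ c ∈ E, (S : ℕ∞) ≤ analyticOrderAt (fun z => f z - H z) c := fun c hc =>
    Baker1975.Analytic.le_analyticOrderAt_of_iteratedDeriv_eq_zero hg (hjets c hc)
  -- bounds on the circle `|z| = R`
  have hR : 0 < R := by linarith
  have hB0 : 0 ≤ B := by
    have hz : ((R : ℝ) : ℂ) ∈ sphere (0 : ℂ) R := by simp [hR.le]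
    exact (norm_nonneg _).trans (hB _ hz)
  have hθ : ∀ z ∈ sphere (0 : ℂ) R, ‖f z - H z‖ ≤ B + 𝓗 R := by
    intro z hz
    have hzR : ‖z‖ ≤ R := by
      have : ‖z‖ = R := by simpa using hz
      exact this.le
    exact (norm_sub_le _ _).trans (add_le_add (hB z hz) (hHb hR.le hzR))
  have hm : 0 < (R - r) ^ (S * E.card) := pow_pos (by linarith) _
  have hmF : ∀ z ∈ sphere (0 : ℂ) R, (R - r) ^ (S * E.card) ≤ ‖∏ c ∈ E, (z - c) ^ S‖ := by
    intro z hz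
    have hzR : ‖z‖ = R := by simpa using hz
    refine Baker1975.Analytic.le_norm_prod_pow E S (by linarith) fun c hc => ?_
    have := norm_sub_norm_le z c
    have := hE c hc
    linarith
  have key := Baker1975.Analytic.norm_le_of_analyticOrderAt hg E S horder hR hθ hm hmF
    (hw.trans hρR)
  have hprodw : ‖∏ c ∈ E, (w - c) ^ S‖ ≤ (ρ + r) ^ (S * E.card) :=
    Baker1975.Analytic.norm_prod_pow_le E S fun c hc =>
      (norm_sub_le _ _).trans (add_le_add hw (hE c hc))
  -- assemble
  have h1 : ‖f w‖ ≤ ‖H w‖ + ‖f w - H w‖ := by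
    have := norm_add_le (H w) (f w - H w)
    rwa [add_sub_cancel] at this
  have h𝓗R : 0 ≤ 𝓗 R := by simp only [h𝓗]; positivity
  calc ‖f w‖ ≤ ‖H w‖ + ‖f w - H w‖ := h1
    _ ≤ 𝓗 ρ + (B + 𝓗 R) / (R - r) ^ (S * E.card) * ‖∏ c ∈ E, (w - c) ^ S‖ :=
        add_le_add (hHb hρ hw) key
    _ ≤ 𝓗 ρ + (B + 𝓗 R) / (R - r) ^ (S * E.card) * (ρ + r) ^ (S * E.card) := by
        gcongr
    _ = 𝓗 ρ + (B + 𝓗 R) * ((ρ + r) / (R - r)) ^ (S * E.card) := by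
        rw [div_pow]; ring

end Hermite

end Literature.NumberTheory.Transcendental

end
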